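import Mathlib.Data.Fintype.Perm
import Summits.AtomisticToContinuum.HydrodynamicLimit.Theorems.CollisionIsometryCLTHsFreeEnergyConvexBasic
import Literature.Analysis.FluidPDE.HardSphereTorusMeasure
import Literature.MathematicalPhysics.KineticTheory.GoodConfigurations
import HarnessLib

/-!
# The body-centred-cubic a-priori bound on the hard-sphere free volume (stub `fv_bcc_lower`)

Helper for support item stmt-AtomisticToContinuum-14870 (`MacroClosure`, line `IdeatorTwoGen1Sketch`,
wave 3, statics input `stub_hsFreeEnergyConvex`): at the fixed density `η = 6/5` (above the top
`11/10` of the convexity range, below the body-centred-cubic packing density `3√3/4 ≈ 1.299` in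
diameter units) the free volume of `N` hard spheres of diameter `d = ((6/5)/N)^{1/3}` on the unit
torus `𝕋³` is exponentially small at worst: `hsFreeVolume (6/5) N ≥ e^{-CN}` for `N ≥ N₀`.

The proof is the classical "lattice packing with wiggle room" argument:

* `FvBccLower.bcc_sep`, `FvBccLower.exists_bcc_config`: the `2m³` points of the body-centred-cubic
  arrangement `((2a + b)/(2m))_{l}`, `a ∈ {0,…,m-1}³`, `b ∈ {0, 1}`, of `𝕋³` are pairwise at
  minimal-image distance `≥ √3/(2m)` (same sub-lattice: one coordinate is a non-zero multiple of
  `1/m`; different sub-lattices: all three coordinates have odd numerator over `2m`);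
* `FvBccLower.factorial_mul_pow_le_volume_posDomain`: if `N` sites are `D`-separated and
  `ε + 2r ≤ D`, `2r < D`, `r < 1/2`, the `N!` boxes "particle `i` in the minimal-image `r`-ball about
  site `σ(i)`", `σ ∈ 𝔖_N`, are pairwise disjoint, lie in the non-overlap set `posDomain ε N`, and each
  has Haar measure `vol(B_r)^N`; hence `N! · vol(B_r)^N ≤ vol (posDomain ε N)`;
* `fv_bcc_lower`: with `m` minimal such that `N ≤ 2m³` (so `2(m-1)³ < N`), `r = d/200`, the
  separation `d + 2r < √3/(2m)` holds for `m ≥ 100` (a rational inequality after cubing, using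
  `433/250 ≤ √3`), and `N! (K/N)^N ≥ e^{-N} K^N` (`N^N/N! ≤ e^N`) with
  `K = 200⁻³ · (6/5) · vol(B₁)`, i.e. `C = 1 - log K`.

Reference: D. Ruelle, *Statistical Mechanics: Rigorous Results* (1969), §3.4 (free volume of a
lattice packing with wiggle room).
-/

namespace Summit.AtomisticToContinuum.HydrodynamicLimit.Theorems.MacroClosureLine

open MeasureTheory Filter Set Topology
open scoped ENNReal
open Literature.MathematicalPhysics.KineticTheory Literature.Analysis.FluidPDE Literature.Analysis.FunctionSpaces

namespace Barycentric

namespace FvBccLower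

/-! ### Circle distances of grid points -/

/-- A point `(2w + 1)/(2m)` of the unit circle `ℝ/ℤ` with odd numerator is at distance `≥ 1/(2m)`
from `0`: for every integer `R`, `(2w+1)/(2m) - R = (2(w - Rm) + 1)/(2m)` has odd, hence non-zero,
numerator. [folklore] -/
theorem inv_le_norm_odd_div {m : ℕ} (hm : 0 < m) (w : ℤ) :
    (2 * (m : ℝ))⁻¹ ≤ ‖(((2 * (w : ℝ) + 1) / (2 * m) : ℝ) : UnitAddCircle)‖ := by
  rw [UnitAddCircle.norm_eq]
  set R : ℤ := round ((2 * (w : ℝ) + 1) / (2 * m)) with hR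
  have hm' : (0 : ℝ) < 2 * m := by positivity
  have key : (2 * (w : ℝ) + 1) / (2 * m) - R = (((2 * (w - R * m) + 1 : ℤ)) : ℝ) / (2 * m) := by
    push_cast
    field_simp
    ring
  have hne : (2 * (w - R * m) + 1 : ℤ) ≠ 0 := by omega
  have h1 : (1 : ℝ) ≤ |(((2 * (w - R * m) + 1 : ℤ)) : ℝ)| := by
    rw [← Int.cast_abs]
    exact_mod_cast Int.one_le_abs hne
  rw [key, abs_div, abs_of_pos hm', le_div_iff₀ hm', inv_mul_cancel₀ hm'.ne']
  exact h1

/-- Two points of the grid `(2m)⁻¹ℤ/ℤ` with numerators `2a + b` and `2a' + b'` of different parities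
(`b + b' = 1`) are at circle distance `≥ 1/(2m)`. [folklore] -/
theorem bcc_coord_odd {m a a' b b' : ℕ} (hm : 0 < m) (hb : b + b' = 1) :
    (2 * (m : ℝ))⁻¹ ≤ ‖((((2 * a + b : ℕ) : ℝ) / (2 * m) : ℝ) : UnitAddCircle) -
      ((((2 * a' + b' : ℕ) : ℝ) / (2 * m) : ℝ) : UnitAddCircle)‖ := by
  have hb' : (b' : ℤ) = 1 - b := by omega
  have e : ((2 * a + b : ℕ) : ℝ) / (2 * m) - ((2 * a' + b' : ℕ) : ℝ) / (2 * m) =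
      (2 * (((a : ℤ) - a' + b - 1 : ℤ) : ℝ) + 1) / (2 * m) := by
    have h2 : ((2 * a' + b' : ℕ) : ℝ) = 2 * (a' : ℝ) + 1 - b := by
      have : ((2 * a' + b' : ℕ) : ℤ) = 2 * (a' : ℤ) + 1 - b := by push_cast; omega
      exact_mod_cast this
    rw [h2]
    push_cast
    ring
  rw [← AddCircle.coe_sub, e]
  exact inv_le_norm_odd_div hm _

/-- Two points of the grid `(2m)⁻¹ℤ/ℤ` with numerators `2a + b ≠ 2a' + b` of the same parity,
`a, a' < m`, are at circle distance `≥ 1/m` (`inv_le_norm_sub_div_unitAddCircle`). [folklore] -/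
theorem bcc_coord_even {m a a' b : ℕ} (hm : 0 < m) (ha : a < m) (ha' : a' < m) (h : a ≠ a') :
    (m : ℝ)⁻¹ ≤ ‖((((2 * a + b : ℕ) : ℝ) / (2 * m) : ℝ) : UnitAddCircle) -
      ((((2 * a' + b : ℕ) : ℝ) / (2 * m) : ℝ) : UnitAddCircle)‖ := by
  have hm' : (m : ℝ) ≠ 0 := by exact_mod_cast hm.ne'
  have e : ((2 * a + b : ℕ) : ℝ) / (2 * m) - ((2 * a' + b : ℕ) : ℝ) / (2 * m) =
      (a : ℝ) / m - (a' : ℝ) / m := by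
    push_cast
    field_simp
    ring
  rw [← AddCircle.coe_sub, e, AddCircle.coe_sub]
  exact inv_le_norm_sub_div_unitAddCircle hm ha ha' h

/-- If every coordinate circle distance of two points of `𝕋³` is `≥ t ≥ 0`, their minimal-image
distance is `≥ √3 t` (`euclidDist = (∑ ‖xᵢ - yᵢ‖²)^{1/2}`). [folklore] -/
theorem sqrt_three_mul_le_euclidDist {x y : T3} {t : ℝ} (ht : 0 ≤ t) (h : ∀ l, t ≤ ‖x l - y l‖) :
    Real.sqrt 3 * t ≤ Torus.euclidDist x y := by
  rw [euclidDist_eq_sqrt,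
    show Real.sqrt 3 * t = Real.sqrt (3 * t ^ 2) by rw [Real.sqrt_mul (by norm_num), Real.sqrt_sq ht]]
  refine Real.sqrt_le_sqrt ?_
  calc 3 * t ^ 2 = ∑ _l : Fin 3, t ^ 2 := by simp
    _ ≤ ∑ l, ‖x l - y l‖ ^ 2 := Finset.sum_le_sum fun l _ => pow_le_pow_left₀ ht (h l) 2

/-! ### The body-centred-cubic arrangement -/

/-- **Separation of the body-centred-cubic arrangement.** The points `x, y` of `𝕋³` with circle
coordinates `x_l = (2 a_l + b)/(2m)`, `y_l = (2 a'_l + b')/(2m)` (`a, a' ∈ {0,…,m-1}³`, `b, b' ∈ {0,1}`: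
corners `b = 0` and body centres `b = 1` of the cubic grid of mesh `1/m`) with `(a, b) ≠ (a', b')`
are at minimal-image distance `≥ √3/(2m)`. [folklore] -/
theorem bcc_sep {m : ℕ} (hm : 0 < m) {a a' : Fin 3 → Fin m} {b b' : Fin 2} (h : a ≠ a' ∨ b ≠ b')
    {x y : T3} (hx : ∀ l, x l = ((((2 * (a l : ℕ) + (b : ℕ) : ℕ) : ℝ) / (2 * m) : ℝ) : UnitAddCircle))
    (hy : ∀ l, y l = ((((2 * (a' l : ℕ) + (b' : ℕ) : ℕ) : ℝ) / (2 * m) : ℝ) : UnitAddCircle)) :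
    Real.sqrt 3 / (2 * m) ≤ Torus.euclidDist x y := by
  have hm' : (0 : ℝ) < m := by exact_mod_cast hm
  by_cases hb : b = b'
  · subst hb
    have ha : a ≠ a' := by
      rcases h with ha | hb
      · exact ha
      · exact absurd rfl hb
    obtain ⟨l, hl⟩ := Function.ne_iff.1 ha
    have hl' : (a l : ℕ) ≠ a' l := fun h => hl (Fin.ext h)
    have h1 : (m : ℝ)⁻¹ ≤ ‖x l - y l‖ := by
      rw [hx l, hy l]
      exact bcc_coord_even hm (a l).isLt (a' l).isLt hl'
    have h2 : ‖x l - y l‖ ≤ Torus.euclidDist x y := norm_apply_sub_le_euclidDist x y l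
    have h3 : Real.sqrt 3 / (2 * m) ≤ (m : ℝ)⁻¹ := by
      have hs : Real.sqrt 3 ≤ 2 := by
        rw [Real.sqrt_le_left (by norm_num)]
        norm_num
      rw [div_le_iff₀ (by positivity), inv_mul_eq_div, le_div_iff₀ hm']
      nlinarith
    linarith
  · have hbb : (b : ℕ) + (b' : ℕ) = 1 := by
      have h1 := b.isLt
      have h2 := b'.isLt
      have h3 : (b : ℕ) ≠ b' := fun h => hb (Fin.ext h)
      omega
    have h1 : ∀ l, (2 * (m : ℝ))⁻¹ ≤ ‖x l - y l‖ := fun l => by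
      rw [hx l, hy l]
      exact bcc_coord_odd hm hbb
    have h2 := sqrt_three_mul_le_euclidDist (by positivity) h1
    rw [div_eq_mul_inv]
    exact h2

/-- **Body-centred-cubic configurations.** If `N ≤ 2m³` there are `N` points of `𝕋³` at mutual
minimal-image distance `≥ √3/(2m)` (distinct points of the body-centred-cubic arrangement of mesh
`1/m`). [folklore] -/
theorem exists_bcc_config {m N : ℕ} (hm : 0 < m) (hN : N ≤ 2 * m ^ 3) :
    ∃ p : Fin N → T3, ∀ i j, i ≠ j → Real.sqrt 3 / (2 * m) ≤ Torus.euclidDist (p i) (p j) := by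
  classical
  have hcard : Fintype.card (Fin N) ≤ Fintype.card ((Fin 3 → Fin m) × Fin 2) := by
    simp only [Fintype.card_prod, Fintype.card_fun, Fintype.card_fin]
    omega
  obtain ⟨e⟩ := Function.Embedding.nonempty_of_card_le hcard
  refine ⟨fun i l => ((((2 * ((e i).1 l : ℕ) + ((e i).2 : ℕ) : ℕ) : ℝ) / (2 * m) : ℝ) : UnitAddCircle),
    fun i j hij => ?_⟩
  have hne : (e i).1 ≠ (e j).1 ∨ (e i).2 ≠ (e j).2 := by
    by_contra hc
    push Not at hc
    exact hij (e.injective (Prod.ext hc.1 hc.2))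
  exact bcc_sep hm hne (fun l => rfl) (fun l => rfl)

/-! ### Boxes of wiggle balls about separated sites -/

/-- The Haar measure of a box of minimal-image `r`-balls, `r < 1/2`, is `vol(B_r)^N`
(`Measure.pi_pi`, `Torus.volume_euclidDist_lt`). [folklore] -/
theorem volume_pi_ballT {N : ℕ} (y : Fin N → T3) {r : ℝ} (hr : r < 1 / 2) :
    volume (Set.pi Set.univ fun i => {x : T3 | Torus.euclidDist x (y i) < r}) =
      volume (Metric.ball (0 : EuclideanSpace ℝ (Fin 3)) r) ^ N := by
  have hvol : (volume : Measure (Fin N → T3)) = Measure.pi fun _ => volume := rfl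
  rw [hvol, Measure.pi_pi]
  simp_rw [Torus.volume_euclidDist_lt hr]
  rw [Finset.prod_const, Finset.card_univ, Fintype.card_fin]

/-- Finitely many pairwise disjoint measurable sets of equal measure `c` inside `S` give
`card · c ≤ μ S`. [folklore] -/
theorem card_mul_le_measure_of_disjoint {ι α : Type*} [Fintype ι] [MeasurableSpace α]
    (μ : Measure α) {B : ι → Set α} {S : Set α} {c : ℝ≥0∞} (hmeas : ∀ i, MeasurableSet (B i))
    (hdisj : Pairwise (Function.onFun Disjoint B)) (hvol : ∀ i, μ (B i) = c) (hsub : ∀ i, B i ⊆ S) :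
    (Fintype.card ι : ℝ≥0∞) * c ≤ μ S := by
  calc (Fintype.card ι : ℝ≥0∞) * c = ∑ i : ι, μ (B i) := by
        simp only [hvol, Finset.sum_const, Finset.card_univ, nsmul_eq_mul]
    _ = μ (⋃ i, B i) := by rw [measure_iUnion hdisj hmeas, tsum_fintype]
    _ ≤ μ S := measure_mono (Set.iUnion_subset hsub)

/-- **Wiggle boxes.** If the sites `p : Fin N → 𝕋³` are `D`-separated, `r < 1/2`, `2r < D` and
`ε + 2r ≤ D`, then `N! · vol(B_r)^N ≤ vol (posDomain ε N)`: the `N!` boxes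
`{q | ∀ i, dist(qᵢ, p_{σ i}) < r}`, `σ ∈ 𝔖_N`, are pairwise disjoint (two `r`-balls about distinct
sites are disjoint), each has measure `vol(B_r)^N`, and each lies in the non-overlap set
(`dist(qᵢ, qⱼ) ≥ dist(p_{σi}, p_{σj}) - 2r ≥ D - 2r ≥ ε`). [cite: Ruelle1969, §3.4] -/
theorem factorial_mul_pow_le_volume_posDomain {N : ℕ} {p : Fin N → T3} {D r ε : ℝ}
    (hp : ∀ i j, i ≠ j → D ≤ Torus.euclidDist (p i) (p j)) (hr : r < 1 / 2) (hrD : 2 * r < D)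
    (hε : ε + 2 * r ≤ D) :
    (N.factorial : ℝ≥0∞) * volume (Metric.ball (0 : EuclideanSpace ℝ (Fin 3)) r) ^ N ≤
      volume (posDomain ε N) := by
  classical
  have key := card_mul_le_measure_of_disjoint (volume : Measure (Fin N → T3))
    (B := fun σ : Equiv.Perm (Fin N) =>
      Set.pi Set.univ fun i => {x : T3 | Torus.euclidDist x (p (σ i)) < r})
    (S := posDomain ε N) (c := volume (Metric.ball (0 : EuclideanSpace ℝ (Fin 3)) r) ^ N)
    ?_ ?_ ?_ ?_
  · rwa [Fintype.card_perm, Fintype.card_fin] at key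
  · -- each box is measurable: minimal-image open balls are open
    intro σ
    exact MeasurableSet.univ_pi fun i =>
      (isOpen_lt (Torus.continuous_euclidDist.comp (continuous_id.prodMk continuous_const))
        continuous_const).measurableSet
  · intro σ τ hστ
    obtain ⟨i, hi⟩ : ∃ i, σ i ≠ τ i := by
      by_contra h
      push Not at h
      exact hστ (Equiv.ext h)
    refine Set.disjoint_left.2 fun q hq hq' => ?_
    have h1 : Torus.euclidDist (q i) (p (σ i)) < r := Set.mem_univ_pi.1 hq i
    have h2 : Torus.euclidDist (q i) (p (τ i)) < r := Set.mem_univ_pi.1 hq' i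
    have h3 := hp (σ i) (τ i) hi
    have h4 := torus_euclidDist_triangle (p (σ i)) (q i) (p (τ i))
    rw [Torus.euclidDist_comm (p (σ i)) (q i)] at h4
    linarith
  · intro σ
    exact volume_pi_ballT (fun i => p (σ i)) hr
  · intro σ q hq i j hij
    have h1 : Torus.euclidDist (q i) (p (σ i)) < r := Set.mem_univ_pi.1 hq i
    have h2 : Torus.euclidDist (q j) (p (σ j)) < r := Set.mem_univ_pi.1 hq j
    have h3 := hp (σ i) (σ j) (σ.injective.ne hij)
    have h4 := euclidDist_sub_sub_le (q i) (q j) (p (σ i)) (p (σ j))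
    linarith

end FvBccLower

open FvBccLower in
/-- **The body-centred-cubic a-priori bound** (registered sub-goal `fv_bcc_lower` of the line
`IdeatorTwoGen1Sketch`): there are `C` and `N₀` with `e^{-CN} ≤ hsFreeVolume (6/5) N` for all
`N ≥ N₀` — at density `6/5 < 3√3/4` the spheres fit on a body-centred-cubic arrangement with wiggle
room `r = d/200`, and the `N!` labelled wiggle boxes have total Haar measure
`N! (vol(B₁) r³)^N ≥ e^{-CN}`. [cite: Ruelle1969, §3.4] -/
theorem fv_bcc_lower : ∃ C : ℝ, ∃ N₀ : ℕ, ∀ N : ℕ, N₀ ≤ N →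
    Real.exp (-(C * N)) ≤ hsFreeVolume (6 / 5) N := by
  classical
  set v : ℝ := (volume (Metric.ball (0 : EuclideanSpace ℝ (Fin 3)) 1)).toReal with hv
  have hv0 : 0 < v :=
    ENNReal.toReal_pos (Metric.measure_ball_pos volume _ one_pos).ne' measure_ball_lt_top.ne
  set K : ℝ := (1 / 200) ^ 3 * (6 / 5) * v with hK
  have hK0 : 0 < K := by positivity
  refine ⟨1 - Real.log K, 2000000, fun N hN => ?_⟩
  have hNpos : 0 < N := by omega
  have hN' : (0 : ℝ) < N := by exact_mod_cast hNpos
  -- the mesh: `m` minimal with `N ≤ 2 m³`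
  have hex : ∃ m : ℕ, N ≤ 2 * m ^ 3 :=
    ⟨N, by nlinarith [Nat.one_le_iff_ne_zero.2 hNpos.ne', Nat.pow_le_pow_left hNpos 2]⟩
  obtain ⟨m, hm, hmin⟩ : ∃ m : ℕ, N ≤ 2 * m ^ 3 ∧ ∀ k < m, ¬N ≤ 2 * k ^ 3 :=
    ⟨Nat.find hex, Nat.find_spec hex, fun k hk => Nat.find_min hex hk⟩
  have hm100 : 100 ≤ m := by
    by_contra h
    push Not at h
    have h1 : m ^ 3 ≤ 99 ^ 3 := Nat.pow_le_pow_left (by omega) 3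
    norm_num at h1
    omega
  have hm0 : 0 < m := by omega
  have hmR : (0 : ℝ) < m := by exact_mod_cast hm0
  have hmR100 : (100 : ℝ) ≤ m := by exact_mod_cast hm100
  have hminR : 2 * ((m : ℝ) - 1) ^ 3 < N := by
    have h1 : ¬N ≤ 2 * (m - 1) ^ 3 := hmin (m - 1) (by omega)
    have h2 : ((2 * (m - 1) ^ 3 : ℕ) : ℝ) < N := by exact_mod_cast not_le.1 h1
    have h3 : ((m - 1 : ℕ) : ℝ) = (m : ℝ) - 1 := by
      rw [Nat.cast_sub (by omega), Nat.cast_one]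
    push_cast [h3] at h2
    exact h2
  -- the sites
  obtain ⟨p, hp⟩ := exists_bcc_config hm0 hm
  -- the diameter and the wiggle radius
  set d : ℝ := ((6 / 5 : ℝ) / N) ^ (1 / 3 : ℝ) with hd
  have hd0 : 0 < d := Real.rpow_pos_of_pos (by positivity) _
  have hd3 : d ^ 3 = (6 / 5 : ℝ) / N := by
    rw [hd, show (1 / 3 : ℝ) = ((3 : ℕ) : ℝ)⁻¹ by norm_num,
      Real.rpow_inv_natCast_pow (by positivity) (by norm_num)]
  have hd1 : d ≤ 1 := by
    refine Real.rpow_le_one (by positivity) ?_ (by norm_num)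
    rw [div_le_one hN']
    have : (2 : ℝ) ≤ N := by exact_mod_cast (show 2 ≤ N by omega)
    linarith
  set r : ℝ := d / 200 with hr_def
  have hr0 : 0 < r := by positivity
  have hr : r < 1 / 2 := by
    rw [hr_def]
    linarith
  -- the separation `d + 2r < √3/(2m)`
  have hkey : d + 2 * r < Real.sqrt 3 / (2 * m) := by
    have e1 : (d + 2 * r) ^ 3 = (101 / 100) ^ 3 * ((6 / 5 : ℝ) / N) := by
      rw [← hd3, hr_def]
      ring
    have e2 : (101 / 100 : ℝ) ^ 3 * ((6 / 5 : ℝ) / N) < (433 / (500 * m)) ^ 3 := by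
      have h1 : (99 / 100 : ℝ) * m ≤ (m : ℝ) - 1 := by linarith
      have h2 : ((99 / 100 : ℝ) * m) ^ 3 ≤ ((m : ℝ) - 1) ^ 3 := pow_le_pow_left₀ (by positivity) h1 3
      have h3 : 2 * ((99 / 100 : ℝ) * m) ^ 3 < N := lt_of_le_of_lt (by linarith) hminR
      have h4 : (101 / 100 : ℝ) ^ 3 * ((6 / 5 : ℝ) / N) < 433 ^ 3 / (500 ^ 3 * (m : ℝ) ^ 3) := by
        rw [lt_div_iff₀ (by positivity),
          show (101 / 100 : ℝ) ^ 3 * ((6 / 5 : ℝ) / N) * (500 ^ 3 * (m : ℝ) ^ 3) =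
            (101 / 100 : ℝ) ^ 3 * (6 / 5) * (500 ^ 3 * (m : ℝ) ^ 3) / N by ring,
          div_lt_iff₀ hN']
        nlinarith [h3]
      calc (101 / 100 : ℝ) ^ 3 * ((6 / 5 : ℝ) / N) < 433 ^ 3 / (500 ^ 3 * (m : ℝ) ^ 3) := h4
        _ = (433 / (500 * m)) ^ 3 := by rw [div_pow, mul_pow]
    have e3 : (433 / (500 * m) : ℝ) ≤ Real.sqrt 3 / (2 * m) := by
      have hs : (433 / 250 : ℝ) ≤ Real.sqrt 3 := by
        rw [Real.le_sqrt (by norm_num) (by norm_num)]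
        norm_num
      rw [div_le_div_iff₀ (by positivity) (by positivity)]
      nlinarith [hs, hmR]
    have h4 : d + 2 * r < 433 / (500 * m) := by
      refine lt_of_pow_lt_pow_left₀ 3 (by positivity) ?_
      rw [e1]
      exact e2
    exact h4.trans_le e3
  -- the wiggle boxes
  have hbound := factorial_mul_pow_le_volume_posDomain (ε := d) hp hr (by linarith) hkey.le
  rw [EosCesaro.hsFreeVolume_eq_toReal]
  have hfin : volume (posDomain d N) ≠ ⊤ := measure_ne_top _ _
  have htoReal : ((N.factorial : ℝ≥0∞) *
      volume (Metric.ball (0 : EuclideanSpace ℝ (Fin 3)) r) ^ N).toReal =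
        N.factorial * (r ^ 3 * v) ^ N := by
    rw [ENNReal.toReal_mul, ENNReal.toReal_pow, ENNReal.toReal_natCast,
      Measure.addHaar_ball_of_pos volume (0 : EuclideanSpace ℝ (Fin 3)) hr0,
      finrank_euclideanSpace_fin, ENNReal.toReal_mul, ENNReal.toReal_ofReal (by positivity)]
  have hrv : r ^ 3 * v = K / N := by
    rw [hr_def, hK, div_pow, hd3]
    field_simp
  -- Stirling-free factorial bound `N^N ≤ e^N N!`
  have hfac : (0 : ℝ) < N.factorial := by exact_mod_cast Nat.factorial_pos N
  have hNN : (0 : ℝ) < (N : ℝ) ^ N := by positivity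
  have hexpN : (N : ℝ) ^ N ≤ Real.exp N * N.factorial := by
    have h := Real.pow_div_factorial_le_exp (N : ℝ) (Nat.cast_nonneg N) N
    rwa [div_le_iff₀ hfac] at h
  have lhs : Real.exp (-((1 - Real.log K) * N)) = K ^ N / Real.exp N := by
    rw [show -((1 - Real.log K) * N) = N * Real.log K - N by ring, Real.exp_sub, Real.exp_nat_mul,
      Real.exp_log hK0]
  calc Real.exp (-((1 - Real.log K) * N)) ≤ N.factorial * (r ^ 3 * v) ^ N := by
        rw [lhs, hrv, div_pow, div_le_iff₀ (Real.exp_pos _),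
          show (N.factorial : ℝ) * (K ^ N / (N : ℝ) ^ N) * Real.exp N =
            K ^ N * (Real.exp N * N.factorial / (N : ℝ) ^ N) by ring]
        have h1 : 1 ≤ Real.exp N * N.factorial / (N : ℝ) ^ N := by
          rw [le_div_iff₀ hNN]
          linarith
        exact le_mul_of_one_le_right (pow_nonneg hK0.le N) h1
    _ = ((N.factorial : ℝ≥0∞) *
          volume (Metric.ball (0 : EuclideanSpace ℝ (Fin 3)) r) ^ N).toReal := htoReal.symm
    _ ≤ (volume (posDomain d N)).toReal := ENNReal.toReal_mono hfin hbound

end Barycentric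

end Summit.AtomisticToContinuum.HydrodynamicLimit.Theorems.MacroClosureLine
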